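import Summits.BirchSwinnertonDyer.BirchSwinnertonDyer.Theses.SignedLowerHalves
import Summits.BirchSwinnertonDyer.BirchSwinnertonDyer.Theorems.SignedLowerHalvesKobayashiMainConjectureSmallImageFineMuAnyReduction
import Summits.BirchSwinnertonDyer.BirchSwinnertonDyer.Theorems.SignedLowerHalvesKobayashiMainConjectureSmallImageMuSaturation
import Summits.BirchSwinnertonDyer.Rank1Residual.X10.CoreTheoremAOddPrimeHolds
import Literature.NumberTheory.EllipticCurves.Kobayashi2003.SignedColemanKatoZeta
import Literature.NumberTheory.EllipticCurves.Rank1Residual.PeriodUnitProofs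
import HarnessLib

/-!
# Route `SignedLowerHalves`, crux `KobayashiMainConjectureSmallImage` (item stmt-BirchSwinnertonDyer-19002):
# the EULER-SYSTEM `μ`-TRANSFER at NON-SURJECTIVE image, part 3 — «`μ(L_p^ε(E)) = 0 ⟹
# μ(X^ε(E/ℚ_∞)) = 0`» CLASS-WIDE for Kobayashi's signed Selmer groups, and the registered stub
# `stub_saturationSmallImage` PARTNER-FREE modulo published facts and that one analytic rider
# (cell `bsd-ssimc`, WIDTH-LEVER lane B = seat `bsd-ssimc-k3-c4x` g0; helper file,
# `--supports stmt-BirchSwinnertonDyer-19002 --as helper`; theorems only)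

HONEST FRAMING.  Kobayashi's signed main conjecture at a non-surjective image is OPEN and stays so
(its Eisenstein half `stub_lowerSmallImage` has no engine in print); nothing here is booked; BSD is
not proved by any of this.  The theorems below are CONDITIONAL on displayed named facts — ONE
CONSTRUCTION fact `Kobayashi2003.thm62_63_73_signedColemanKato_zeta` (Kobayashi 2003 Thm. 6.2/6.3/7.3
(7.21) at `η = 1` with Kato Thm. 12.6 on pinned objects; this seat, p529649, reviewed) and PUBLISHED
facts (Kobayashi Thm. 1.2, Thm. 4.1 RATIONAL, the period-unit pair) — and on ONE analytic rider per
pair: the sign-`ε` Pollack function of `E` has a `p`-adic unit coefficient (`μ(L_p^ε(E)) = 0`, decidable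
per pair).  NO partner curve, NO congruence, NO preprint, NO image hypothesis beyond «not onto».

PARTITION (cell bsd-ssimc): X7 (A7) × item 4's ENTIRE domain (odd good supersingular `p`, `a_p = 0`,
`ρ̄_{E,p}` not onto; 136 window pairs) — types-the-object-of; closes NONE.

## The road (lane A's complement)

Lane A (`bsd-ssimc-k3-c4`) reduced the registered stub `stub_saturationSmallImage` («lower ⇒
equality») to «`μ(X^ε(E/ℚ_∞)) = 0`» (p447454) and supplied `μ = 0` PER PAIR from a congruence
PARTNER.  Here `μ(X^ε) = 0` comes from `E` ITSELF — rung K6's Kato `μ`-transfer WITHOUT big image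
(`X10.mu_eq_zero_of_fine`; at `p ∥ N` `MultMu.mu_eq_zero_of_multFine`) run at a good SUPERSINGULAR
prime with Kobayashi's `±` Coleman maps in place of Kato's Prop. 17.11: unit coefficient of
`L_p^ε(E)` ⟹ (Thm. 6.3 on ideals at `(p)` + Kato Thm. 12.6 span clause) a GENUINE Euler-system
class `∉ p𝐇¹` ⟹ (reduction-free core `CoreAssembly.coreOdd_anyReduction_holds`, part 1)
`length_(p) X₀(E/ℚ_∞) = 0` ⟹ ((7.21) through `Col^ε`, part 1's bookkeeping) `length_(p) X^ε = 0`.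

## Contents (theorems only; every non-published input a DISPLAYED binder)

* §1 `signedMu_eq_zero_of_hasUnitContent` — odd good `p`, `a_p = 0`, `ρ̄_{E,p}` NOT surjective,
  newform `f`, period ratio `ϖ`, sign-`ε` Pollack function `L` with `HasUnitContent L` ⟹ every
  `D : SignedSelmerDualData W κ γ ε` has `D.mu = 0`, modulo `hCK` (the construction fact) and the
  period-unit pair `h5`/`h3`; `…_of_isPollackPair` — the same in Pollack-pair currency.
* §2 `kobayashiMainConjecture_of_signedMuAn_of_lowerDivisibility` (§1 ∘ lane A's saturation, ANY
  rank, NO partner); `stub_saturationSmallImage_of_signedMuAn` — the REGISTERED stub (skeleton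
  `Lines/birth.lean`, sha16 b1bf5b11c746572b) VERBATIM as conclusion, modulo `hCK`, `h12`, `h41`,
  `h5`, `h3` and the class-wide analytic rider `hμan`; `kobayashiMainConjectureSmallImage_of_lower_of_signedMuAn`
  — the crux BY NAME from the `stub_lowerSmallImage` statement (binder), the rider and the facts.
* §3 two PARTNER-FREE rank-`0` doors: `kobayashiMainConjecture_of_signedMuAn_of_bsdp_of_analyticRank_eq_zero`
  (lane A's image-free converse with its `μ = 0` binder discharged by §1) and
  `kobayashiMainConjecture_of_lvalue_unit` (the UNIT CASE: `L(E,1)/Ω_E ∈ ℤ_(p)ˣ` ⟹ the main [C]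
  for BOTH signs — `L^ε ∈ Λˣ` by Kobayashi (3.6), `μ(X^ε) = 0` by §1, `ξ ∣ L^ε` by Thm. 4.1 rational +
  Gauss; NO partner, NO `BSD(E,p)` input, NO descent certificate).

NOT here: the Eisenstein half (no engine); any class-wide source of the analytic rider (Pollack's
`μ = 0`, per pair a finite certificate — lane A's E-side rows); anything booked.
References: [Kobayashi2003] Thm. 1.2, 4.1, 6.2, 6.3, 7.3 (7.21), (3.6); [Kato2004Asterisque] Thm.
12.6, Ex. 13.3, §13.8, §17.13; [GreenbergVatsal2000] §3; [GreenbergLNM1716] §1 Conj. 1.11; [Pollack2003];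
tree: part 1 (this seat, p528404), lane A's `…SmallImageMuSaturation` (p447454),
`Theorems/ErratumRoadFiveNonSurjCornerMuCore` (bsd-stepL, p486975), `Kobayashi2003/SignedColemanKatoZeta`
(this seat, p529649).
-/

set_option linter.dupNamespace false
set_option autoImplicit false

noncomputable section

open scoped Classical MatrixGroups ModularForm

open CongruenceSubgroup WeierstrassCurve Field
  Literature.NumberTheory.EllipticCurves Literature.NumberTheory.EllipticCurves.ModularForms
  Literature.NumberTheory.EllipticCurves.Rank1Residual
  Literature.NumberTheory.EllipticCurves.Kobayashi2003 Literature.NumberTheory.EllipticCurves.Kato2004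
  Literature.NumberTheory.EllipticCurves.GreenbergVatsal2000 ZpExtension
  Summit.BirchSwinnertonDyer.Rank1Residual.Supersingular
  Summit.BirchSwinnertonDyer.BirchSwinnertonDyer.Rank1Residual

namespace Summit.BirchSwinnertonDyer.BirchSwinnertonDyer.Theorems.SmallImageSignedMuTransfer

/-! ### §1 `μ(L_p^ε(E)) = 0 ⟹ μ(X^ε(E/ℚ_∞)) = 0` at non-surjective image, class-wide -/

section Transfer

variable (W : WeierstrassCurve ℚ) [W.IsElliptic] [W.IsGloballyMinimal] (p : ℕ) [Fact p.Prime]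

/-- **The signed Kato `μ`-transfer WITHOUT big image (the `±` twin of `X10.mu_eq_zero_of_fine`).**
Let `W/ℚ` be globally minimal, `p` an ODD prime of good reduction with `a_p = 0` (so supersingular and
`E[p]` irreducible) and `ρ̄_{E,p}` NOT surjective; let `f` be a newform of `W` with period ratio `ϖ`
(`ϖ·Ω_E = Ω⁺_f`), `ε` a sign and `L ∈ Λ` the sign-`ε` Pollack function of `f` (Kobayashi's labelling,
`IsSignedPAdicLFunction f p ε L`) with a `p`-adic UNIT coefficient (`HasUnitContent L`, i.e.
`μ(L_p^ε(E)) = 0`).  Granted the CONSTRUCTION fact `hCK` (Kobayashi Thm. 6.2/6.3/7.3 (7.21) at `η = 1`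
with Kato Thm. 12.6, `Kobayashi2003.thm62_63_73_signedColemanKato_zeta`) and the period-unit pair
`h5`/`h3` (`ϖ ∈ ℤ_pˣ` under `Irr`): every Pontryagin-dual datum `D` of `Sel^ε(E/ℚ_∞)` in the cyclotomic
setting `(κ, γ)` has `μ = 0`.  Chain: `G₁ := C(u)·L` (`u = ϖ`) is Kobayashi's Néron-normalised
`L_p^ε ∈ Λ`, `G₁ ∉ (p)`; the image clause at `𝔭 = (p)` and the span clause give a genuine Euler-system
class `∉ p𝐇¹_Γ(T_pW)` (part 1 `exists_mem_set_not_mem_pSmul`); the reduction-free core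
(`CoreAssembly.coreOdd_anyReduction_holds`) gives `length_(p) X₀(E/ℚ_∞) = 0` (part 1); (7.21) through
`Col^ε` gives `length_(p) X^ε ≤ length_(p) X₀` (part 1); `μ = length_(p)`.  CONDITIONAL on the displayed
binders; NO partner, NO congruence, NO preprint; the image enters only as «not onto».
[cite: Kobayashi2003, Thm. 6.2 (6.13)–(6.14), Thm. 6.3 (p. 11) and Thm. 7.3 i) (7.21) (p. 13)]
[cite: Kato2004Asterisque, Thm. 12.6 (p. 222), Ex. 13.3 (p. 225), §13.8 (pp. 228–229)]
[cite: GreenbergVatsal2000, §3 Remark 3.4 (period unit)] -/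
theorem signedMu_eq_zero_of_hasUnitContent (hCK : thm62_63_73_signedColemanKato_zeta)
    (h5 : realPeriodRat_eq_unit_mul_plusPeriod) (h3 : realPeriodRat_eq_unit_mul_plusPeriod_three)
    (hp : p ≠ 2) (hgood : W.HasGoodReductionAtPrime p) (hap : W.frobeniusTrace p = 0)
    (hns : ¬ W.HasSurjectiveModNGaloisRep p)
    {N : ℕ} [NeZero N] (f : CuspForm (Gamma0 N) 2) (hf : IsNewformOf W f)
    (ϖ : ℚ) (hϖ : (ϖ : ℝ) * W.realPeriodRat = plusPeriod f)
    {ε : ℤˣ} {L : IwasawaAlgebra p} (hL : IsSignedPAdicLFunction f p ε L) (hu : HasUnitContent L)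
    (κ : ZpExtension ℚ p) (γ : absoluteGaloisGroup ℚ) (hκ : κ.IsCyclotomic) (hγ : κ.IsTopGenerator γ)
    (hγ' : IsCyclotomicVariable p γ) (D : SignedSelmerDualData W κ γ ε) : D.mu = 0 := by
  haveI : ContinuousSMul ℤ_[p] (W.tateModule p) := TateModule.continuousSMul_padicInt
  haveI : Module.Free ℤ_[p] (W.tateModule p) := W.module_free_tateModule_holds p
  haveI : Module.Finite ℤ_[p] (W.tateModule p) := W.module_finite_tateModule_holds p
  -- supersingular ⟹ `E[p]` irreducible
  have hirr : W.HasIrreducibleModPGaloisRep p :=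
    hasIrreducibleModPGaloisRep_of_dvd_frobeniusTrace W p hp
      (W.not_dvd_minimalDiscriminantInt_of_hasGoodReductionAtPrime' p hgood) (by rw [hap]; exact dvd_zero _)
  -- the pinned objects `𝐇¹_Γ(T_pW)`, `X₀(E/ℚ_∞)` and the package
  obtain ⟨I⟩ := nonempty_iwasawaH1Data_holds W p κ γ hκ hγ
  obtain ⟨Y⟩ := W.nonempty_fineSelmerDualData κ hγ
  obtain ⟨K⟩ := hCK W p f ϖ κ γ hp hgood hap hf hϖ hκ hγ hγ' ε I
  obtain ⟨j, k, hcj, hjk, -⟩ := K.exact D Y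
  -- the period ratio is a `p`-adic unit: `ϖ = u`, and `G₁ := C(u)·L` is Kobayashi's `L_p^ε ∈ Λ`
  have hvϖ : padicValRat p ϖ = 0 :=
    Rank1Residual.padicValRat_periodRatio_eq_zero h5 h3 W p hp hgood hirr f hf ϖ hϖ
  have hϖ0 : ϖ ≠ 0 := by
    intro hz
    rw [hz, Rat.cast_zero, zero_mul] at hϖ
    exact (IsNewform0.plusPeriod_pos_holds hf.1 hf.coeffField_eq_bot).ne' hϖ.symm
  obtain ⟨u, hu'⟩ := exists_units_coe_eq_ratCast hϖ0 hvϖ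
  obtain ⟨-, hι⟩ := span_C_units_mul_eq u L
  set G₁ : IwasawaAlgebra p := PowerSeries.C (u : ℤ_[p]) * L with hG₁def
  have hG₁ : iwasawaToPowerSeries p G₁ =
      PowerSeries.C ((ϖ : ℚ) : ℚ_[p]) * iwasawaToPowerSeries p L := by rw [hι, hu']
  -- `L ∉ (p)` (unit content), hence `G₁ ∉ (p)`
  have hLp : L ∉ IwasawaAlgebra.augIdealP p := KatoMuSkeleton.not_mem_augIdealP_of_hasUnitContent hu
  have hG₁p : G₁ ∉ IwasawaAlgebra.augIdealP p := by
    intro h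
    apply hLp
    have h' := Ideal.mul_mem_left (IwasawaAlgebra.augIdealP p) (PowerSeries.C ((u⁻¹ : ℤ_[p]ˣ) : ℤ_[p])) h
    rwa [hG₁def, ← mul_assoc, ← map_mul, Units.inv_mul, map_one, one_mul] at h'
  -- the image clause at `𝔭 = (p)` and the span clause: a genuine Euler-system class outside `p𝐇¹`
  let 𝔭 : PrimeSpectrum (IwasawaAlgebra p) :=
    ⟨IwasawaAlgebra.augIdealP p, IwasawaAlgebra.isPrime_augIdealP_holds p⟩
  obtain ⟨s, hs, hsG, -⟩ :=
    K.image_zeta_localized hirr L G₁ hL hG₁ 𝔭 (by exact IwasawaAlgebra.height_augIdealP_holds p)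
  obtain ⟨z, hzES, hzp⟩ := exists_mem_set_not_mem_pSmul K.col K.Z K.zeta_le_span hs hG₁p hsG
  -- the reduction-free core: `length_(p) X₀(E/ℚ_∞) = 0`
  obtain ⟨_, hY0⟩ := fineSelmerDual_lengthAt_augIdealP_eq_zero_of_eulerSystemClass W p κ γ I hp hirr
    hns hκ hγ ⟨z, hzES, hzp⟩ Y 𝔭 rfl
  -- (7.21) through `Col^ε`: `length_(p) X^ε ≤ length_(p) X₀ = 0`
  have hX0 : Module.lengthAt (IwasawaAlgebra p) D.X 𝔭 = 0 :=
    le_antisymm ((lengthAt_le_of_exact_coleman_of_image_localized K.col j k hcj hjk K.Z 𝔭 hs hG₁p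
      hsG).trans hY0.le) bot_le
  change muInvariant p D.X = 0
  rw [muInvariant_eq_toNat_lengthAt p D.X 𝔭 rfl, hX0]
  rfl

/-- **The same in the Pollack-pair currency of `KobayashiMainConjecture`**: for a Pollack pair
`(L⁺, L⁻)` of `f` (`IsPollackPair`, Pollack's labelling) and a sign `ε` with
`HasUnitContent (kobayashiL ε L⁺ L⁻)` (Kobayashi's `L_p^ε`), every dual datum of `Sel^ε(E/ℚ_∞)` has
`μ = 0`.  [cite: Kobayashi2003, Thm. 3.2 (p. 7), Thm. 6.3 (p. 11) and Thm. 7.3 i) (p. 13)]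
[cite: Pollack2003, Thm. 5.6 and Cor. 5.11] -/
theorem signedMu_eq_zero_of_isPollackPair (hCK : thm62_63_73_signedColemanKato_zeta)
    (h5 : realPeriodRat_eq_unit_mul_plusPeriod) (h3 : realPeriodRat_eq_unit_mul_plusPeriod_three)
    (hp : p ≠ 2) (hgood : W.HasGoodReductionAtPrime p) (hap : W.frobeniusTrace p = 0)
    (hns : ¬ W.HasSurjectiveModNGaloisRep p)
    {N : ℕ} [NeZero N] (f : CuspForm (Gamma0 N) 2) (hf : IsNewformOf W f)
    (ϖ : ℚ) (hϖ : (ϖ : ℝ) * W.realPeriodRat = plusPeriod f)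
    {Lplus Lminus : IwasawaAlgebra p} (hPP : IsPollackPair f p Lplus Lminus) (ε : ℤˣ)
    (hu : HasUnitContent (kobayashiL ε Lplus Lminus))
    (κ : ZpExtension ℚ p) (γ : absoluteGaloisGroup ℚ) (hκ : κ.IsCyclotomic) (hγ : κ.IsTopGenerator γ)
    (hγ' : IsCyclotomicVariable p γ) (D : SignedSelmerDualData W κ γ ε) : D.mu = 0 :=
  signedMu_eq_zero_of_hasUnitContent W p hCK h5 h3 hp hgood hap hns f hf ϖ hϖ
    (hPP.isSignedPAdicLFunction_kobayashiL ε) hu κ γ hκ hγ hγ' D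

end Transfer

/-! ### §2 Saturation at small image WITHOUT a partner: the registered stub modulo the analytic rider -/

section Saturation

variable (W : WeierstrassCurve ℚ) [W.IsElliptic] [W.IsGloballyMinimal] (p : ℕ) [Fact p.Prime]

/-- **`lower ⇒ equality` at non-surjective image from `E`'s OWN signed `p`-adic `L`-function.**
Let `p` be an odd prime of good reduction of `E = W` with `a_p = 0` and `ρ̄_{E,p}` NOT surjective,
and suppose that for the sign `ε` SOME newform `f` of `W` (any level), period ratio `ϖ` and sign-`ε`
Pollack function `L` has a `p`-adic unit coefficient (`hμan`: `μ(L_p^ε(E)) = 0`).  Granted BY NAME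
the construction fact `hCK`, Kobayashi Thm. 1.2 (`h12`), Thm. 4.1 RATIONAL (`h41`) and the period-unit
pair (`h5`, `h3`): the Eisenstein half `KobayashiLowerDivisibility W p ε` implies
`KobayashiMainConjecture W p ε` — §1 ∘ lane A's `kobayashiMainConjecture_of_mu_eq_zero_of_lowerDivisibility`
(p447454).  ANY analytic rank; NO partner, NO congruence, NO preprint, NO `BSD(E,p)` input.
[cite: Kobayashi2003, Thm. 1.2 (p. 2), Thm. 4.1 (p. 8), Thm. 6.3 (p. 11), Thm. 7.3 (p. 13) and Conjecture (p. 2)]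
[cite: Kato2004Asterisque, Thm. 12.6 (p. 222) and §13.8 (pp. 228–229)] [cite: GreenbergVatsal2000, §3 Remark 3.4] -/
theorem kobayashiMainConjecture_of_signedMuAn_of_lowerDivisibility
    (hCK : thm62_63_73_signedColemanKato_zeta)
    (h12 : Kobayashi2003.thm12_signedSelmerDual_finite_torsion)
    (h41 : Kobayashi2003.thm41_signedCharIdeal_divisibility)
    (h5 : realPeriodRat_eq_unit_mul_plusPeriod) (h3 : realPeriodRat_eq_unit_mul_plusPeriod_three)
    (hp : p ≠ 2) (hgood : W.HasGoodReductionAtPrime p) (hap : W.frobeniusTrace p = 0)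
    (hns : ¬ W.HasSurjectiveModNGaloisRep p) {ε : ℤˣ}
    (hμan : ∃ (N : ℕ) (_ : NeZero N) (f : CuspForm (Gamma0 N) 2) (ϖ : ℚ) (L : IwasawaAlgebra p),
      IsNewformOf W f ∧ (ϖ : ℝ) * W.realPeriodRat = plusPeriod f ∧
        IsSignedPAdicLFunction f p ε L ∧ HasUnitContent L)
    (hlow : KobayashiLowerDivisibility W p ε) : KobayashiMainConjecture W p ε := by
  obtain ⟨N, _, f, ϖ, L, hf, hϖ, hL, hu⟩ := hμan
  exact kobayashiMainConjecture_of_mu_eq_zero_of_lowerDivisibility W p h12 h41 h5 h3 hp hgood hap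
    (fun κ γ hκ hγ hγ' D ↦ signedMu_eq_zero_of_hasUnitContent W p hCK h5 h3 hp hgood hap hns f hf ϖ hϖ
      hL hu κ γ hκ hγ hγ' D) hlow

end Saturation


/-! ### §3 Two partner-free rank-`0` doors (class-level theorems with per-pair decidable hypotheses) -/

section RankZero

variable (W : WeierstrassCurve ℚ) [W.IsElliptic] [W.IsGloballyMinimal] (p : ℕ) [Fact p.Prime]

/-- **The IMAGE-FREE rank-`0` converse with `μ` from `E` itself:** odd good `p`, `a_p = 0`, `ρ̄_{E,p}`
NOT onto, `ord_{s=1} L(E,s) = 0`, `BSD(E,p)` settled, and the analytic rider for the sign `ε`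
(`μ(L_p^ε(E)) = 0`) ⟹ `KobayashiMainConjecture W p ε` — lane A's
`kobayashiMainConjecture_of_mu_eq_zero_of_bsdp_of_analyticRank_eq_zero` (p447454) with its displayed
`μ(X^ε) = 0` binder DISCHARGED by §1 (no partner).  Binders: `hCK`, `h12`, `h41` (rational), `hKim`,
`h5`, `h3`, `hGZK`, `hmod'` by name; `hμan`, `h0`, `hB` displayed.  CONDITIONAL; per pair.
[cite: Kobayashi2003, Thm. 1.2 (p. 2), Thm. 4.1 (p. 8), (3.6) (p. 7), Thm. 6.3 (p. 11), Thm. 7.3 (p. 13)]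
[cite: BDKim2013, Cor. 3.15 (p. 199)] [cite: Miller2011LMS, Def. 1.1] -/
theorem kobayashiMainConjecture_of_signedMuAn_of_bsdp_of_analyticRank_eq_zero
    (hCK : thm62_63_73_signedColemanKato_zeta)
    (h12 : Kobayashi2003.thm12_signedSelmerDual_finite_torsion)
    (h41 : Kobayashi2003.thm41_signedCharIdeal_divisibility)
    (hKim : BDKim2013.cor315_signedCharValue_rankZero)
    (h5 : realPeriodRat_eq_unit_mul_plusPeriod) (h3 : realPeriodRat_eq_unit_mul_plusPeriod_three)
    (hGZK : rank_eq_analyticRank_of_analyticRank_le_one) (hmod' : hasEntireLFunction_rat)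
    (hp : p ≠ 2) (hgood : W.HasGoodReductionAtPrime p) (hap : W.frobeniusTrace p = 0)
    (hns : ¬ W.HasSurjectiveModNGaloisRep p) {ε : ℤˣ}
    (hμan : ∃ (N : ℕ) (_ : NeZero N) (f : CuspForm (Gamma0 N) 2) (ϖ : ℚ) (L : IwasawaAlgebra p),
      IsNewformOf W f ∧ (ϖ : ℝ) * W.realPeriodRat = plusPeriod f ∧
        IsSignedPAdicLFunction f p ε L ∧ HasUnitContent L)
    (h0 : W.analyticRank = 0) (hB : BSDp W p) : KobayashiMainConjecture W p ε := by
  obtain ⟨N, _, f, ϖ, L, hf, hϖ, hL, hu⟩ := hμan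
  exact kobayashiMainConjecture_of_mu_eq_zero_of_bsdp_of_analyticRank_eq_zero W p h12 h41 hKim h5 h3
    hGZK hmod' hp hgood hap
    (fun κ γ hκ hγ hγ' D ↦ signedMu_eq_zero_of_hasUnitContent W p hCK h5 h3 hp hgood hap hns f hf ϖ hϖ
      hL hu κ γ hκ hγ hγ' D) h0 hB

/-- **The UNIT CASE at small image, partner-free: `ord_p(L(E,1)/Ω_E) = 0 ⟹` Kobayashi's main
[C] for BOTH signs.**  Let `p` be an odd good prime of `E = W` with `a_p = 0` and `ρ̄_{E,p}` NOT onto,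
and suppose `L(E,1)/Ω_E = t ∈ ℚ` is a non-zero `p`-adic UNIT (`ht`, `ht0`, `hvt`).  Then for every sign
`ε`, `KobayashiMainConjecture W p ε`: by Kobayashi (3.6) (`IsPollackPair.constantCoeff_kobayashiL`,
PROVED) `L^ε(0) = c_ε · L(E,1)/Ω⁺_f = c_ε · t/ϖ` is a unit (`p ∤ c_ε ∈ {2, p−1}`, `ϖ ∈ ℤ_pˣ`), so
`L^ε ∈ Λˣ` and `μ(L^ε) = 0`; §1 gives `μ(X^ε) = 0`, i.e. a characteristic power series `ξ` of unit
content; Kobayashi Thm. 4.1 RATIONAL + Gauss (lane A's `signedUpper_dvd_of_hasUnitContent`) gives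
`ξ ∣ L^ε`, so `ξ ∈ Λˣ` and `char X^ε = Λ = (ϖ·L^ε)`.  BOTH halves are trivial in this case; the
content is §1.  Binders: `hCK`, `h12`, `h41` (rational), `h5`, `h3` by name; `ht`, `ht0`, `hvt`
displayed (one rational number per pair).  NO partner, NO congruence, NO `BSD(E,p)` input, NO descent
certificate, NO preprint.  CONDITIONAL; per pair; nothing booked.
[cite: Kobayashi2003, (3.6) (p. 7), Thm. 1.2 (p. 2), Thm. 4.1 (p. 8), Thm. 6.3 (p. 11), Thm. 7.3 (p. 13) and p. 2 (the main [C])]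
[cite: GreenbergVatsal2000, §3 Remark 3.4] [cite: Washington1997, §7.1 (units of Λ)] -/
theorem kobayashiMainConjecture_of_lvalue_unit (hCK : thm62_63_73_signedColemanKato_zeta)
    (h12 : Kobayashi2003.thm12_signedSelmerDual_finite_torsion)
    (h41 : Kobayashi2003.thm41_signedCharIdeal_divisibility)
    (h5 : realPeriodRat_eq_unit_mul_plusPeriod) (h3 : realPeriodRat_eq_unit_mul_plusPeriod_three)
    (hp : p ≠ 2) (hgood : W.HasGoodReductionAtPrime p) (hap : W.frobeniusTrace p = 0)
    (hns : ¬ W.HasSurjectiveModNGaloisRep p)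
    {t : ℚ} (ht : W.entireLFunction 1 / (W.realPeriodRat : ℂ) = ((t : ℚ) : ℂ)) (ht0 : t ≠ 0)
    (hvt : padicValRat p t = 0) (ε : ℤˣ) : KobayashiMainConjecture W p ε := by
  intro κ γ hκ hγ hγ' _ f hf ϖ hϖ Lplus Lminus hPP D
  have hpP : p.Prime := Fact.out
  haveI hfin : Module.Finite (IwasawaAlgebra p) D.X := h12.moduleFinite hp hgood hap hκ hγ D
  have hX : Module.IsTorsion (IwasawaAlgebra p) D.X := h12.isTorsion hp hgood hap hκ hγ D
  refine ⟨hX, ?_⟩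
  set L := kobayashiL ε Lplus Lminus with hL_def
  have hL : IsSignedPAdicLFunction f p ε L := hPP.isSignedPAdicLFunction_kobayashiL ε
  -- irreducibility from supersingularity; the period ratio is a unit
  have hirr : W.HasIrreducibleModPGaloisRep p :=
    hasIrreducibleModPGaloisRep_of_dvd_frobeniusTrace W p hp
      (W.not_dvd_minimalDiscriminantInt_of_hasGoodReductionAtPrime' p hgood) (by rw [hap]; exact dvd_zero _)
  have hvϖ : padicValRat p ϖ = 0 :=
    Rank1Residual.padicValRat_periodRatio_eq_zero h5 h3 W p hp hgood hirr f hf ϖ hϖ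
  have hϖ0 : ϖ ≠ 0 := by
    intro hz
    rw [hz, Rat.cast_zero, zero_mul] at hϖ
    exact (IsNewform0.plusPeriod_pos_holds hf.1 hf.coeffField_eq_bot).ne' hϖ.symm
  -- (P): `L(0) = c_ε · s`, `s = [0]⁺_f`, and `t = ϖ · s`
  have hLε := hPP.constantCoeff_kobayashiL hp hf hgood hap ε
  set s : ℚ := ratPlusSymbol f 0 with hs_def
  have hLval : W.entireLFunction 1 = (((s : ℝ) * plusPeriod f : ℝ) : ℂ) := hf.entireLFunction_one_eq
  have hts : t = ϖ * s := by
    have h1 : W.entireLFunction 1 / (W.realPeriodRat : ℂ) = (((ϖ * s : ℚ) : ℝ) : ℂ) := by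
      rw [hLval, ← hϖ, div_eq_iff (Complex.ofReal_ne_zero.mpr W.realPeriodRat_pos_holds.ne')]
      push_cast
      ring
    rw [ht] at h1
    exact_mod_cast h1
  have hs0 : s ≠ 0 := by
    intro hz
    exact ht0 (by rw [hts, hz, mul_zero])
  have hvs : padicValRat p s = 0 := by
    have := hvt
    rw [hts, padicValRat.mul hϖ0 hs0, hvϖ, zero_add] at this
    exact this
  -- `L(0)` is a `p`-adic unit, hence `L ∈ Λˣ` and `μ(L) = 0`
  have hcne : kobayashiConst p ε ≠ 0 := fun hz ↦
    not_dvd_kobayashiConst hp ε (by rw [hz]; exact dvd_zero p)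
  have hc0 : (kobayashiConst p ε : ℚ_[p]) ≠ 0 := by exact_mod_cast hcne
  have hsQ0 : ((s : ℚ) : ℚ_[p]) ≠ 0 := by exact_mod_cast hs0
  have hL0ne : ((PowerSeries.constantCoeff L : ℤ_[p]) : ℚ_[p]) ≠ 0 := by
    rw [hLε]; exact mul_ne_zero hc0 hsQ0
  have hvL : (((PowerSeries.constantCoeff L : ℤ_[p]) : ℚ_[p])).valuation = 0 := by
    rw [hLε, Padic.valuation_mul hc0 hsQ0, Padic.valuation_natCast,
      padicValNat.eq_zero_of_not_dvd (not_dvd_kobayashiConst hp ε), Padic.valuation_ratCast, hvs]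
    simp
  have hnorm : ‖((PowerSeries.constantCoeff L : ℤ_[p]) : ℚ_[p])‖ = 1 := by
    rw [Padic.norm_eq_zpow_neg_valuation hL0ne, hvL, neg_zero, zpow_zero]
  have hunit0 : IsUnit (PowerSeries.constantCoeff L : ℤ_[p]) := PadicInt.isUnit_iff.mpr hnorm
  have hLunit : IsUnit L := PowerSeries.isUnit_iff_constantCoeff.mpr hunit0
  have hu : HasUnitContent L := ⟨0, by rwa [PowerSeries.coeff_zero_eq_constantCoeff]⟩
  -- §1: `μ(X^ε) = 0`, so a characteristic power series `ξ` of unit content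
  have hμ : D.mu = 0 :=
    signedMu_eq_zero_of_hasUnitContent W p hCK h5 h3 hp hgood hap hns f hf ϖ hϖ hL hu κ γ hκ hγ hγ' D
  obtain ⟨ξ, hξ⟩ := (charIdeal_isPrincipal_holds p D.X).principal
  have hξ' : D.charIdeal = Ideal.span {ξ} := hξ
  have huξ : HasUnitContent ξ := (muInvariant_eq_zero_iff_hasUnitContent D.X hX hξ').mp hμ
  -- Thm. 4.1 rational + Gauss: `ξ ∣ L`, so `ξ` is a unit and `char X^ε = Λ`
  have hU : ξ ∣ L := signedUpper_dvd_of_hasUnitContent h41 hp hgood hap hf hκ hγ hγ' hL D hX hξ' huξ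
  have hξunit : IsUnit ξ := isUnit_of_dvd_unit hU hLunit
  obtain ⟨u, hu'⟩ := exists_units_coe_eq_ratCast hϖ0 hvϖ
  obtain ⟨hspan', hι⟩ := span_C_units_mul_eq u L
  have h1 : D.charIdeal = ⊤ := by rw [hξ']; exact (Ideal.span_singleton_eq_top).mpr hξunit
  have h2 : Ideal.span ({PowerSeries.C (u : ℤ_[p]) * L} : Set (IwasawaAlgebra p)) = ⊤ := by
    rw [hspan']; exact (Ideal.span_singleton_eq_top).mpr hLunit
  exact ⟨PowerSeries.C (u : ℤ_[p]) * L, h1.trans h2.symm, by rw [hι, hu']⟩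

end RankZero

/-- **The REGISTERED stub `stub_saturationSmallImage` of crux `KobayashiMainConjectureSmallImage`
(skeleton `Cruxes/KobayashiMainConjectureSmallImage/Lines/birth.lean`, sha16 b1bf5b11c746572b) as the
CONCLUSION, verbatim — `∀ W p, p ≠ 2 → ClassX7 W p → ¬CM → a_p = 0 → ¬Surj W p → ∀ ε, lower ⇒
equality` — modulo: the construction fact `hCK` (Kobayashi Thm. 6.2/6.3/7.3 + Kato 12.6 at `η = 1`),
the PUBLISHED facts `h12`, `h41` (rational clause only), `h5`, `h3`, and the CLASS-WIDE analytic rider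
`hμan` («on item 4's domain, for every sign, the sign-`ε` Pollack function of `E` has a unit
coefficient» — Greenberg's/Pollack's `μ(L_p^±) = 0`; a finite certificate per pair).  NO partner, NO
congruence, NO preprint.  The CM hypothesis and `ClassX7`'s non-semistability are not used (the road
is image- and level-blind beyond «`ρ̄` not onto»).  Nothing booked; crux 4 stays OPEN (its Eisenstein
half has no engine).  [cite: Kobayashi2003, Thm. 1.2 (p. 2), Thm. 4.1 (p. 8), Thm. 6.2–6.3 (p. 11), Thm. 7.3 (p. 13)]
[cite: Kato2004Asterisque, Thm. 12.6 (p. 222), §13.8 (pp. 228–229)] [cite: GreenbergLNM1716, §1 Conj. 1.11 (the rider's class-wide form)] -/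
theorem stub_saturationSmallImage_of_signedMuAn (hCK : thm62_63_73_signedColemanKato_zeta)
    (h12 : Kobayashi2003.thm12_signedSelmerDual_finite_torsion)
    (h41 : Kobayashi2003.thm41_signedCharIdeal_divisibility)
    (h5 : realPeriodRat_eq_unit_mul_plusPeriod) (h3 : realPeriodRat_eq_unit_mul_plusPeriod_three)
    (hμan : ∀ (W : WeierstrassCurve ℚ) [W.IsElliptic] [W.IsGloballyMinimal] (p : ℕ) [Fact p.Prime],
      p ≠ 2 → ClassX7 W p → ¬ W.HasCM → W.frobeniusTrace p = 0 → ¬ Surj W p → ∀ ε : ℤˣ,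
      ∃ (N : ℕ) (_ : NeZero N) (f : CuspForm (Gamma0 N) 2) (ϖ : ℚ) (L : IwasawaAlgebra p),
        IsNewformOf W f ∧ (ϖ : ℝ) * W.realPeriodRat = plusPeriod f ∧
          IsSignedPAdicLFunction f p ε L ∧ HasUnitContent L) :
    ∀ (W : WeierstrassCurve ℚ) [W.IsElliptic] [W.IsGloballyMinimal] (p : ℕ) [Fact p.Prime],
      p ≠ 2 → ClassX7 W p → ¬ W.HasCM → W.frobeniusTrace p = 0 → ¬ Surj W p →
      ∀ ε : ℤˣ, Summit.BirchSwinnertonDyer.Rank1Residual.Supersingular.KobayashiLowerDivisibility W p ε →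
        Summit.BirchSwinnertonDyer.Rank1Residual.Supersingular.KobayashiMainConjecture W p ε := by
  intro W _ _ p _ hp hX hcm hap hs ε hlow
  exact kobayashiMainConjecture_of_signedMuAn_of_lowerDivisibility W p hCK h12 h41 h5 h3 hp hX.1.1 hap hs
    (hμan W p hp hX hcm hap hs ε) hlow

/-- **The crux BY NAME from its registered Eisenstein stub, the analytic rider and named facts** —
the skeleton's composition `KobayashiMainConjectureSmallImage_of` with `stub_saturationSmallImage`
DISCHARGED by this road: granted `hCK`, `h12`, `h41`, `h5`, `h3`, the statement of the registered stub
`stub_lowerSmallImage` (`hlower`, the Eisenstein half at small image — OPEN, no engine in print) and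
the class-wide analytic rider `hμan`, the route decl
`Theses.SignedLowerHalves.KobayashiMainConjectureSmallImage` holds.  So crux 4 READS: Eisenstein half
∧ `μ(L_p^ε(E)) = 0` on the class, modulo published facts plus ONE construction fact transcribing
Kobayashi 2003 / Kato 2004.  CONDITIONAL; nothing asserted beyond the binders; nothing booked.
[cite: Kobayashi2003, Conjecture (Main Conjecture) (p. 2), Thm. 4.1 (p. 8), Thm. 6.3 (p. 11), Thm. 7.3 (p. 13)]
[cite: Kato2004Asterisque, Thm. 12.6 (p. 222), §13.8 (pp. 228–229)] -/
theorem kobayashiMainConjectureSmallImage_of_lower_of_signedMuAn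
    (hCK : thm62_63_73_signedColemanKato_zeta)
    (h12 : Kobayashi2003.thm12_signedSelmerDual_finite_torsion)
    (h41 : Kobayashi2003.thm41_signedCharIdeal_divisibility)
    (h5 : realPeriodRat_eq_unit_mul_plusPeriod) (h3 : realPeriodRat_eq_unit_mul_plusPeriod_three)
    (hlower : ∀ (W : WeierstrassCurve ℚ) [W.IsElliptic] [W.IsGloballyMinimal] (p : ℕ) [Fact p.Prime],
      p ≠ 2 → ClassX7 W p → ¬ W.HasCM → W.frobeniusTrace p = 0 → ¬ Surj W p →
      ∃ ε : ℤˣ, Summit.BirchSwinnertonDyer.Rank1Residual.Supersingular.KobayashiLowerDivisibility W p ε)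
    (hμan : ∀ (W : WeierstrassCurve ℚ) [W.IsElliptic] [W.IsGloballyMinimal] (p : ℕ) [Fact p.Prime],
      p ≠ 2 → ClassX7 W p → ¬ W.HasCM → W.frobeniusTrace p = 0 → ¬ Surj W p → ∀ ε : ℤˣ,
      ∃ (N : ℕ) (_ : NeZero N) (f : CuspForm (Gamma0 N) 2) (ϖ : ℚ) (L : IwasawaAlgebra p),
        IsNewformOf W f ∧ (ϖ : ℝ) * W.realPeriodRat = plusPeriod f ∧
          IsSignedPAdicLFunction f p ε L ∧ HasUnitContent L) :
    Summit.BirchSwinnertonDyer.BirchSwinnertonDyer.Theses.SignedLowerHalves.KobayashiMainConjectureSmallImage := by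
  intro W _ _ p _ hp hX hcm hap hs
  obtain ⟨ε, hε⟩ := hlower W p hp hX hcm hap hs
  exact ⟨ε, stub_saturationSmallImage_of_signedMuAn hCK h12 h41 h5 h3 hμan W p hp hX hcm hap hs ε hε⟩

end Summit.BirchSwinnertonDyer.BirchSwinnertonDyer.Theorems.SmallImageSignedMuTransfer

end
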